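import Summits.Ventures.PercRepro.Benchmarks
import Summits.Ventures.PercRepro.Certify4

/-!
# Gladkov–Zimin Sept 2024, Theorem 3.3 (7) by an SMC certificate

The strengthened Harris inequality for two pairs, typer-2's `GZ24Thm33`
(`P(a~b)·P(c~d) + P(a~b ∨ c~d)·(x₂ + x₃) + x₂·x₃ ≤ P(a~b ∧ c~d)`, `x₂ = ac|bd`, `x₃ = ad|bc`),
is an instance of the cell's **single-merge concavity principle at `k = 4`**
(`SMC4Principle_holds`, typer-2 `Certify4.lean`): its kernel `A_GZ33` — the quadratic form
`2·[(Σ_{abcd} π)(Σ π) − (Σ_{a~b} π)(Σ_{c~d} π) − (Σ_{a~b ∨ c~d} π)(π₆ + π₈) − π₆π₈]` in the engine's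
row order — satisfies the decidable `SMC4` condition (`SMC4_A_GZ33`, kernel `decide`).
The bridge from connection events to rows is `prob_eq_sum_law4` (an event determined by the
marked partition is the sum of its rows of `law4`) and `sum_law4` (the rows sum to `1`).
Main result: `GZ24Thm33_holds : GZ24Thm33`.
-/

namespace PercRepro

open Finset

/-- The kernel of Gladkov–Zimin Thm 3.3 (7) in the row order `rgs4`, with `ab = {0,1,2,3,4}`
(`a~b`), `cd = {0,3,5,9,13}` (`c~d`), `abcd = {0,3}`, `U = ab ∪ cd`, `x₂ = 6`, `x₃ = 8`:
`A s t = [s ∈ abcd] + [t ∈ abcd] − [s ∈ ab][t ∈ cd] − [s ∈ cd][t ∈ ab] − [s ∈ U][t ∈ {6,8}]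
  − [t ∈ U][s ∈ {6,8}] − [{s,t} = {6,8}]`, so that `quadForm4 A_GZ33 π = 2·[(Σ_{abcd} π)(Σ π)
  − (Σ_{ab} π)(Σ_{cd} π) − (Σ_U π)(π₆ + π₈) − π₆π₈]` (`quadForm4_A_GZ33`). -/
def A_GZ33 : Matrix (Fin 15) (Fin 15) ℤ := fun s t =>
  (if s = 0 ∨ s = 3 then 1 else 0) + (if t = 0 ∨ t = 3 then 1 else 0) -
    (if (s = 0 ∨ s = 1 ∨ s = 2 ∨ s = 3 ∨ s = 4) ∧ (t = 0 ∨ t = 3 ∨ t = 5 ∨ t = 9 ∨ t = 13)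
      then 1 else 0) -
    (if (t = 0 ∨ t = 1 ∨ t = 2 ∨ t = 3 ∨ t = 4) ∧ (s = 0 ∨ s = 3 ∨ s = 5 ∨ s = 9 ∨ s = 13)
      then 1 else 0) -
    (if (s = 0 ∨ s = 1 ∨ s = 2 ∨ s = 3 ∨ s = 4 ∨ s = 5 ∨ s = 9 ∨ s = 13) ∧ (t = 6 ∨ t = 8)
      then 1 else 0) -
    (if (t = 0 ∨ t = 1 ∨ t = 2 ∨ t = 3 ∨ t = 4 ∨ t = 5 ∨ t = 9 ∨ t = 13) ∧ (s = 6 ∨ s = 8)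
      then 1 else 0) -
    (if (s = 6 ∧ t = 8) ∨ (s = 8 ∧ t = 6) then 1 else 0)

set_option maxRecDepth 8000 in
/-- The kernel of Thm 3.3 satisfies the SMC condition (kernel-checked certificate, 961 checks). -/
theorem SMC4_A_GZ33 : SMC4 A_GZ33 := by decide

/-- The quadratic form of `A_GZ33`, factored. -/
theorem quadForm4_A_GZ33 (π : Fin 15 → ℝ) :
    quadForm4 A_GZ33 π =
      2 * ((π 0 + π 3) * (π 0 + π 1 + π 2 + π 3 + π 4 + π 5 + π 6 + π 7 + π 8 + π 9 + π 10 +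
            π 11 + π 12 + π 13 + π 14) -
          (π 0 + π 1 + π 2 + π 3 + π 4) * (π 0 + π 3 + π 5 + π 9 + π 13) -
          (π 0 + π 1 + π 2 + π 3 + π 4 + π 5 + π 9 + π 13) * (π 6 + π 8) - π 6 * π 8) := by
  simp only [quadForm4, Fin.sum_univ_succ, Fin.sum_univ_zero, A_GZ33]
  simp
  ring

namespace MultiGraph

variable {V E : Type*} (G : MultiGraph V E)

/-- The fibre of the row map over `s` is the partition row `s`. -/
theorem preimage_row4_markedPartition (a b c d : V) (s : Fin 15) :
    (fun ω => row4 (G.markedPartition ω ![a, b, c, d])) ⁻¹' {s} =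
      G.partitionEvent ![a, b, c, d] (rgs4 s) := by
  ext ω
  simp only [Set.mem_preimage, Set.mem_singleton_iff]
  exact G.row4_markedPartition_eq_iff _ s

variable [Fintype E] [DecidableEq E]

/-- **An event determined by the marked partition is the sum of its rows**: if membership in
`A` on the row `s` is the decidable predicate `P s`, then `P(A) = ∑_{s : P s} law4 s`. -/
theorem prob_eq_sum_law4 (p : E → ℝ) (a b c d : V) (A : Set (Config E)) (P : Fin 15 → Prop)
    [DecidablePred P]
    (hA : ∀ s ω, ω ∈ G.partitionEvent ![a, b, c, d] (rgs4 s) → (ω ∈ A ↔ P s)) :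
    prob p A = ∑ s ∈ univ.filter P, G.law4 p a b c d s := by
  rw [prob_eq_sum_fiber p (fun ω => row4 (G.markedPartition ω ![a, b, c, d])), Finset.sum_filter]
  refine Finset.sum_congr rfl fun s _ => ?_
  rw [preimage_row4_markedPartition]
  split_ifs with h
  · unfold law4
    congr 1
    ext ω
    exact ⟨fun hω => hω.2, fun hω => ⟨(hA s ω hω).mpr h, hω⟩⟩
  · have : A ∩ G.partitionEvent ![a, b, c, d] (rgs4 s) = ∅ := by
      ext ω
      simp only [Set.mem_inter_iff, Set.mem_empty_iff_false, iff_false, not_and]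
      exact fun h1 h2 => h ((hA s ω h2).mp h1)
    rw [this, prob_empty]

/-- The rows of `law4` sum to `1`. -/
theorem sum_law4 (p : E → ℝ) (a b c d : V) : ∑ s, G.law4 p a b c d s = 1 := by
  have h := sum_prob_fiber p (fun ω => row4 (G.markedPartition ω ![a, b, c, d]))
  simp only [preimage_row4_markedPartition] at h
  exact h

/-- `P(a~b)` as a row sum. -/
theorem prob_connEvent_eq_sum_law4 (p : E → ℝ) (a b c d : V) (i j : Fin 4) :
    prob p (G.connEvent (![a, b, c, d] i) (![a, b, c, d] j)) =
      ∑ s ∈ univ.filter (fun s => rgs4 s i = rgs4 s j), G.law4 p a b c d s :=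
  G.prob_eq_sum_law4 p a b c d _ (fun s => rgs4 s i = rgs4 s j) fun _ _ hω => hω i j

/-- `P(a~b ∧ c~d)` as a row sum. -/
theorem prob_connEvent_inter_eq_sum_law4 (p : E → ℝ) (a b c d : V) :
    prob p (G.connEvent a b ∩ G.connEvent c d) =
      ∑ s ∈ univ.filter (fun s => rgs4 s 0 = rgs4 s 1 ∧ rgs4 s 2 = rgs4 s 3),
        G.law4 p a b c d s :=
  G.prob_eq_sum_law4 p a b c d _ (fun s => rgs4 s 0 = rgs4 s 1 ∧ rgs4 s 2 = rgs4 s 3)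
    fun _ _ hω => by
      have h01 := hω 0 1
      have h23 := hω 2 3
      simp only [Matrix.cons_val_zero, Matrix.cons_val_one, Matrix.head_cons,
        Matrix.cons_val_two, Matrix.tail_cons, Matrix.cons_val_three] at h01 h23
      exact and_congr h01 h23

end MultiGraph

/-- **Gladkov–Zimin Sept 2024, Theorem 3.3 (7) holds** — by the SMC certificate `A_GZ33`. -/
theorem GZ24Thm33_holds : GZ24Thm33 := by
  intro V E _ _ G p hp a b c d _
  have h := SMC4Principle_holds A_GZ33 SMC4_A_GZ33 G p hp a b c d
  rw [quadForm4_A_GZ33] at h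
  have hsum := G.sum_law4 p a b c d
  have hab := G.prob_connEvent_eq_sum_law4 p a b c d 0 1
  have hcd := G.prob_connEvent_eq_sum_law4 p a b c d 2 3
  have habcd := G.prob_connEvent_inter_eq_sum_law4 p a b c d
  have hU := prob_union_add_inter p (G.connEvent a b) (G.connEvent c d)
  rw [show (univ.filter fun s : Fin 15 => rgs4 s 0 = rgs4 s 1) = {0, 1, 2, 3, 4} from by decide]
    at hab
  rw [show (univ.filter fun s : Fin 15 => rgs4 s 2 = rgs4 s 3) = {0, 3, 5, 9, 13} from by decide]
    at hcd
  rw [show (univ.filter fun s : Fin 15 => rgs4 s 0 = rgs4 s 1 ∧ rgs4 s 2 = rgs4 s 3) = {0, 3} from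
    by decide] at habcd
  simp [Fin.sum_univ_succ] at hsum
  simp [Finset.sum_insert] at hab hcd habcd
  generalize G.law4 p a b c d = π at h hsum hab hcd habcd ⊢
  have hS : π 0 + π 1 + π 2 + π 3 + π 4 + π 5 + π 6 + π 7 + π 8 + π 9 + π 10 + π 11 + π 12 +
      π 13 + π 14 = 1 := by linarith
  rw [hS, mul_one] at h
  rw [hab, hcd, habcd] at hU
  have hU' : prob p (G.connEvent a b ∪ G.connEvent c d) =
      (π 0 + π 1 + π 2 + π 3 + π 4) + (π 0 + π 3 + π 5 + π 9 + π 13) - (π 0 + π 3) := by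
    linarith
  rw [hab, hcd, habcd, hU']
  nlinarith [h]

end PercRepro
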